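import Mathlib
import HarnessLib
import HarnessLib.Audit
import Summits.RiemannHypothesis.Statement
import Literature.NumberTheory.LFunctions.WeilExplicit
import Literature.NumberTheory.LFunctions.RiemannXi
import Literature.NumberTheory.LFunctions.RiemannXiProofs
import Literature.NumberTheory.LFunctions.WeilWindowSimpleEven
import Literature.NumberTheory.LFunctions.WeilGroundEnergyParitySplit
import Literature.NumberTheory.LFunctions.WeilOddGroundState
import HarnessLib.Audit.Status.Attr

/-!
Route: WeilParity

# Route WeilParity — the even sector always wins — RH from the parity order of Weil's window bottoms

X = EVEN SECTOR WINS. Weil's windowed form Q(g) = Re W(g ⋆ g̃) on tests supported in [−a, a]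
commutes with t ↦ −t, so its bottom
splits as ε(a) = min(ε₊(a), ε₋(a)) over even / odd tests (Bombieri2000Weil Thm 5: μ±(M); Suzuki2026
§4.5: λ_a = min(λ_a⁺, λ_a⁻)).
X: for EVERY window a > 0 the even bottom is the lower one, ε₊(a) ≤ ε₋(a) (junk-free: every odd
normalised window test is matched,
up to any δ > 0, by an even one). X is SIGN-BLIND — it says nothing about ε(a) ≥ 0 — and it is the
ORDER half (without simplicity,
isolation or strictness) of Connes' "lowest eigenvalue simple and even" hypothesis (route
WeilGroundState crux GroundStateSimpleEven).
The route's content is the converse crux OffLineParityDetection: an off-line zero of ζ makes the ODD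
sector strictly win at some
window (parity symmetry breaking), so X alone decides RH — no Connes–van Suijlekom real-zeros
theorem, no convergence û_a → ξ.
X = EvenWinsArch ∧ EvenWinsBeyondArch (prime-free windows a ≤ (log 2)/2, and the rest).
Lean: `∀ a : ℝ, 0 < a → ∀ o : ℝ → ℂ, Literature.NumberTheory.LFunctions.IsWeilTest o → tsupport o ⊆
Set.Icc (-a) a → (∀ t, o (-t) = -o t) → ∫ t, ‖o t‖ ^ 2 = (1 : ℝ) → ∀ δ : ℝ, 0 < δ → ∃ e : ℝ → ℂ,
Literature.NumberTheory.LFunctions.IsWeilTest e ∧ tsupport e ⊆ Set.Icc (-a) a ∧ (∀ t, e (-t) = e t)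
∧ ∫ t, ‖e t‖ ^ 2 = (1 : ℝ) ∧ (Literature.NumberTheory.LFunctions.weilQuadratic e).re ≤
(Literature.NumberTheory.LFunctions.weilQuadratic o).re + δ`

## Assembly
Pure logic over tree facts about ξ (Sketch.lean `assembly_proof`, kernel-closed; the deciding
theorem `closes` in glue.lean uses the
three cruxes EvenWinsArch, EvenWinsBeyondArch, OffLineParityDetection): given a nontrivial zero s of
ζ (Mathlib's binder),
`riemannXi_eq_zero_of_nontrivial` + `riemannXi_eq_zero_iff_holds` put it in the open strip; if Re s
≠ 1/2, OffLineParityDetection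
yields a window a, an odd normalised test o and a margin m > 0 with Re Q(o) + m ≤ Re Q(e) for every
even normalised e on the window,
while EvenSectorWins (= ParityGlue of the two ranges) yields an even e with Re Q(e) ≤ Re Q(o) + m/2
— contradiction; so Re s = 1/2.

Rationale: WHY THIS LINE. RECOMBINATION (plan-lens recomb): from route WeilGroundState we take the
parity-sector objects, the certified/numerical facts (even
bottom simple and below the odd bottom at a ≤ 1/100 [Suzuki2026 Thm 1.4], at a = (log 2)/2 [item
ArchimedeanWindowSimpleEven,
proved], and on the scanned grid a ∈ [0.01, 1.2] [Cruxes/GroundStateSimpleEven/Disproof.lean]) and,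
above all, the WAY ITS CRUX
FAILS to be RH-free (BarrierNotes-r1-k1 B1, kit j015456: by the explicit formula an off-line
quadruple {±γ₀ ± iη} enters real even
tests as +4 Re G(z₀)² and real odd tests as −4 Re G(z₀)², and past the visibility window a ≳ (log
log γ₀)/(2η) the ORDER of the two
sector bottoms alternates with period π/γ₀ — 52 flips in the toy); from routes WeilPos /
WeilAdversary we take the converse-criterion
technology (tree: WeilCriterionConverse `riemannHypothesis_of_zeroSide_nonneg` by two-node families;
AdversarialWeilPositivity's
off-line bookkeeping and Paley–Wiener sampling) that turns such a failure mode into a DETECTION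
THEOREM; from route WeilWindowFlow we
take the regularity toolkit for sector minimisers (edge law, weak Euler–Lagrange; Bombieri2000Weil
Thm 5 dilation per sector) and
the division lever o ↦ ∫o (odd ↦ even on the same window, (∫o)^(s) = −ô(s)/(s−½)) for the
calibration RH ⇒ X; from
Bombieri2000Weil Thm 8 the inertia law (one negative eigenvalue per sector per conjugate pair in the
finite model, §13 numerics with the
fake zero .52+3.14i). What the combination buys that no parent had: (i) Connes' evenness hypothesis,
a side condition in
WeilGroundState feeding C–vS + Hurwitz, becomes DECISIVE BY ITSELF — its order half implies RH once
OffLineParityDetection is a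
theorem; (ii) X is a RELATIVE inequality between two infima of ONE form: the super-exponential scale
ε ≍ exp(−4πe^{2a}) that leaves
every absolute positivity statement without margin (NewmanConjecture barrier) CANCELS — in Connes'
prolate model the two sectors are
the defects 1−λ₄(c), 1−λ₆(c) of Slepian's operator (Fourier-sign grading, B1-notes F6), ratio ≍ c² →
∞ (refuter data: odd/even ratio
57 → 640 on a ∈ [0.35, 0.7]), so X holds WITH A GROWING MARGIN where ε ≥ 0 is "barely true"; (iii)
the adversary route's cost law gets
a theorem-shaped target (detection at relative precision η/γ₀) instead of a no-go. Imported area: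
spectral symmetry breaking /
parity sectors of reflection-symmetric nonlocal forms (Beurling–Deny fails for the full form because
of the rank-(1,1) pole form
2|⟨g,cosh t/2⟩|² − 2|⟨g,sinh t/2⟩|², which pushes the even sector UP and pulls the odd sector DOWN —
the competition is genuine).
Parity is the ONLY symmetry of the windowed form (translations and modulations do not preserve the
window class), so this is the
canonical relative criterion. Negatives index: empty at filing.

RANKED CRUXES. #0 EvenSectorWins (target) — for every a > 0, every odd L²-normalised Weil test on
[−a, a] and every δ > 0 there is an even L²-normalised Weil test on [−a, a] whose Re Q exceeds the
odd one's by at most δ (ε₊(a) ≤ ε₋(a): the ground energy is always attained in the even sector).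
(why it might fail: RH-strength by OffLineParityDetection (false iff RH false, if that crux holds);
under RH still only heuristic (prolate model ε₋/ε₊ ≍ c²): an exceptional window where the odd ground
state out-threads the zeros better than the even one would refute X with RH intact.)
[Bombieri2000Weil, Suzuki2026, ConnesSuijlekom2025, Connes2026Letter, ConnesConsani2023]
#2 OffLineParityDetection (crux) — PARITY SYMMETRY BREAKING DETECTS OFF-LINE ZEROS: if ζ(ρ) = 0 with
0 < Re ρ < 1 and Re ρ ≠ 1/2, then at some window a > 0 some odd normalised Weil test o beats every
even normalised Weil test by a fixed margin m > 0 (the odd sector strictly wins). Mechanism: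
explicit formula sector identities (+4 Re G(z₀)² even / −4 Re G(z₀)² odd for real tests), optimal
sinh(ηt)cos/sin(γ₀t) profiles with splitting ∝ e^{2ηa}cos(2γ₀a − φ)/γ₀, on-line detuning
interference of the same order η/γ₀ and the same phase 2γ₀a, Bohr almost-periodicity / Landau-type
sign change in a; infinitely many off-line zeros handled by zero-density and an extremal-offset
selection. [difficulty: XL] (why it might fail: Needs a LOWER bound on the even bottom under ¬RH to
relative precision η/γ₀: on-line detuning interference is of the same order as the off-line
splitting (sinh-profiles have 1/x lobes); with infinitely many off-line zeros no quadruple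
dominates; no Landau lemma for an inf-functional exists.) [Bombieri2000Weil, Yoshida1992,
arXiv:2606.09096, ConnesSuijlekom2025]
#3 EvenWinsBeyondArch (crux) — the thesis on every window a > (log 2)/2 (primes present): every odd
normalised Weil test on [−a, a] is matched up to any δ > 0 by an even one. The RH-bearing half: by
crux #2 it is false under ¬RH; under RH it is Connes' prolate picture (even = Fourier-sign-0 sector
wins by a factor ≍ c²), and the data (odd/even ratio 57 → 640 on [0.35, 0.7], interlacing
even<odd<even… of the first levels on [0.01, 1.2]) support it. [difficulty: open-problem] (why it
might fail: RH-strength (crux #2): any proof must be zero-sensitive (no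
Perron–Frobenius/Beurling–Deny lever survives the pole form +2|⟨g,cosh⟩|²); beyond a ≈ 0.75 both
bottoms are < 1e−11 (precision wall), so numerics arbitrate only the ORDER via ratios, never
absolutely.) [Connes2026Letter, ConnesConsani2023, ConnesSuijlekom2025, Bombieri2000Weil,
arXiv:2605.20224]
#4 EvenWinsArch (crux) — the PRIME-FREE PARITY THEOREM: for 0 < a ≤ (log 2)/2 (no prime power enters
W(g ⋆ g̃); the form is polar + digamma only) the even sector wins, ε₊(a) ≤ ε₋(a), in the same
junk-free matching form. A statement about the archimedean kernel alone, RH-free and certifiable: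
known at a ≤ 1/100 (Suzuki2026 Thm 1.4, strict) and at a = (log 2)/2 (WeilGroundState item
ArchimedeanWindowSimpleEven, proved); the interval in between needs a-uniform certified sector
bounds (Rayleigh–Ritz upper for even, Temple/Lehmann–Goerisch lower for odd) plus the sector
Lipschitz modulus (WeilWindowFlow toolkit). [difficulty: L] (why it might fail: The pole form pushes
the even sector UP by 2|⟨g,cosh(t/2)⟩|² ≈ 4a and pulls the odd sector DOWN by 2|⟨g,sinh(t/2)⟩|²; at
a ≈ 0.35 the push is of the order of the log-symbol parity gap, so the order could flip inside
(1/100, (log 2)/2) despite both endpoints being certified.) [Suzuki2026, ConnesConsani2023,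
Bombieri2000Weil, arXiv:2006.13771]
#9 ParityGlue (support) — pure logic: the two window ranges give the target (case split at a = (log
2)/2); proved in the planner's Sketch.lean (parityGlue_proof). [difficulty: provable-now]
[Bombieri2000Weil]
#9 FiniteDefectParityAlternation (support) — FINITE-DEFECT RUNG of crux #2 (Bombieri's setting, Thm
8 / §13): if the set of off-line zeros of ζ in the strip is finite and nonempty, the odd sector
strictly wins at some window. Here one quadruple of maximal offset η dominates, the splitting ε₋ −
ε₊ is asymptotic to a finite trigonometric sum in a with the common phase 2γ₀a, and Bohr
almost-periodicity gives sign changes — the first honest theorem of the detection mechanism, RH-free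
(its hypothesis is the finite-defect alternative). [difficulty: L] [Bombieri2000Weil, Yoshida1992]
#9 RHImpliesEvenWins (support) — CALIBRATION (open, off the deciding path): RH implies the thesis.
Expected by Connes' prolate model (even sector = Fourier-sign 0, odd = sign 2; defects 1−λ₄(c) ≪
1−λ₆(c)); the cheap division lever (RH ⇒ Q(∫o) ≤ Q(o)/γ₁² for odd o, (∫o)^(s) = −ô(s)/(s−½)) proves
it only at windows whose odd ground state has ‖o‖ ≤ γ₁‖∫o‖, which fails for zero-threading
(high-frequency) minimisers — so a proof needs the prolate approximation of BOTH sector ground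
states. Recorded so that X's exact logical status (equivalent to RH, or strictly stronger) is an
item, not a footnote. [difficulty: open-problem] [Connes2026Letter, ConnesConsani2023,
Bombieri2000Weil]

TWO-LAYER PLAN. Once FiniteDefectParityAlternation lands: OffLineParityDetection ⇐
FiniteDefectParityAlternation → InfiniteDefectParityDetection →
OffLineParityDetection (k = 2; the infinite-defect child selects quadruples of near-maximal offset
and uses zero-density bounds).
Once EvenWinsArch lands: EvenWinsBeyondArch ⇐ (even < odd STRICT on (log 2)/2 < a ≤ A₀, certified) →
(order beyond A₀) with A₀ ≈ 0.7
the precision wall. Nothing filed now.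

KILL CRITERIA. (k1) A proof (or a decisive toy refinement with on-line detuning included) that under
¬RH the even sector STILL always wins — i.e.
¬OffLineParityDetection — closes the route `refuted:OffLineParityDetection` (X then carries no RH
content) and is itself a barrier
note for Connes' programme. (k2) A certified window with ε₋(a) < ε₊(a) among the verified-RH heights
(kit: trig-Galerkin σ± blocks,
mpmath dps ≥ 60, a ∈ [0.8, 2.0], primes ≤ e⁴) refutes EvenWinsBeyondArch while RH stands: close
`refuted:EvenWinsBeyondArch`
(and record that Connes' evenness hypothesis fails at that window). (k3) EvenWinsArch refuted inside
(1/100, (log 2)/2): pivot the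
range split (the thesis survives if the flip is prime-free-specific, else k2). (k4)
GroundStateSimpleEven (route WeilGroundState)
proved for all a moots EvenSectorWins (it implies X); crux #2 then still carries this route.

NOT DECOMPOSED YET. The sector splitting identity (off-line quadruple ↦ ±4 Re G(z₀)² on real
even/odd tests; on-line zeros ↦ Σ|G(γ)|² in both) is the
first lemma of crux #2 and is provable now from `explicit_formula_holds`, but is not filed as an
item (it would be a third layer once

CHEAPEST FALSIFIER. (F1, for crux #2, partly RUN by others) the zero-side toy with one fake off-line
quadruple (kit j015456, Cruxes/GroundStateSimpleEven/
BarrierNotes-r1-k1.md B1): 52 order flips on a ∈ [2.5, 4.5], spacing 0.045 ≈ π/(2γ₀) — SUPPORTS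
detection; the decisive refinement is
the same toy WITH the true sector bottoms resolved at frequencies ≳ γ₀ (Galerkin K ≳ aγ₀) so that
on-line detuning is included: if the
even sector then wins at every a, crux #2 is dead (k1). (F2, for the thesis) extend the refuters' σ±
scan (Disproof.lean: even<odd on
[0.01, 1.2]) to a ∈ [1.2, 2.0] at dps 60: one window with odd < even kills EvenWinsBeyondArch (k2).
(F3, lookup, DONE) Yoshida 1992
(via Suzuki arXiv:2606.09096 p.2): odd-sector POSITIVITY ⇒ RH and even-sector positivity ⇒ RH up to
real zeros — consistent with and
weaker-hypothesis than nothing here (X is sign-blind); Bombieri2000Weil §13: one negative eigenvalue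
per sector under a fake zero,
order not studied — so no printed result settles either crux.

NUMBERS. ε(0.347) = 1.49e−3, ε(0.5) = 1.28e−6, ε(0.6) = 2.56e−9 (refuter data, even sector = global
bottom); odd/even bottom ratio 57 → 640 on
a ∈ [0.35, 0.7] (refuters), 56 → 678 on [0.36, 0.74] (zero-side toy j015435/j015456); both sector
bottoms < 1e−11 for a ≥ 0.75
(Connes2026Letter §6.4, 1−χ₂ law); Suzuki2026 Thm 1.4: simple even positive bottom for a ≤ a₀ (a₀ ≈
1/100 in the tree's rendering);
toy alternation half-period π/(2γ₀) = 0.0446 at γ₀ = 35.26. Items at open: 8.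

DEFINITION REQUESTS. None. IsWeilTest, weilQuadratic
(Literature.NumberTheory.LFunctions.WeilExplicit), riemannZeta (Mathlib), riemannXi facts
(RiemannXiProofs) exist; sector bottoms are kept inline (no `weilGroundEnergyEven/Odd` definition is
requested at open; if provers
want them, `ledger workitem add --kind definition --notion weilSectorGroundEnergy --topic
Literature/NumberTheory/LFunctions`).

Novelty: Searches (2026-08-16): local `lit search` (hybrid/plain) UNAVAILABLE all session (searchd
ConnectionReset; noted in NOTES.md);
`lit search --source openalex|arxiv|s2|zbmath "Weil quadratic form lowest eigenvalue even odd
parity"` → 429 rate-limited / 0 rows;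
`lit galaxy search "Weil positivity" --star pdf` (0), `"Weil quadratic form" --star pdf` (0),
`"simple and even" --star all` (30 rows,
none mathematical); READ: Suzuki arXiv:2606.09096 pp.2,4,13–15 (λ_a = min(λ_a⁺,λ_a⁻); Yoshida 1992
odd-positivity ⇒ RH; "the
assumption in [CCM25] amounts to dim E⁺(λ_a) = 1 and E⁻(λ_a) = {0}"); Bombieri2000Weil (lit
paper:galaxy-pdf-4005501466549090220)
pp.12,16,24–27,38–40 (Thm 5 μ±(M); Thm 8 inertia; §9 even/odd eigenfunctions; §11 "splitting into
even and odd components and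
complexifying with Cramér's V(z)"; §13 fake-zero numerics per sector); tree:
Theses/WeilGroundState.lean, Cruxes/GroundStateSimpleEven
(Disproof.lean, BarrierNotes-r1-k1.md, PICKED.md, six crux ideas), Cruxes/GroundStatesConvergeToXi
(PICKED, krein-quadrature-nodes),
Literature WeilWindowSimpleEven / WeilGroundStateRealZeros / WeilWindowSuzuki; 35 open + 100 closed
summit idea cards (grep parity /
Lee–Yang / sector: no card on the ORDER as a criterion).
Nearest prior art found: Yoshida1992 (odd-sector positivity ⇒ RH; even-sector positivity ⇒ RH up to
real zeros) and Bombieri2000Weil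
Thm 5/Thm 8/§13 (sector bottoms μ±, inertia per conjugate pair, per-sector numerics with a fake
zero); ConnesSuijlekom2025 Thm 6.1 +
C  [refs: 2606.09096, paper:galaxy-pdf-4005501466549090220, Yoshida1992, ConnesSuijlekom2025, Suzuki2026]

Barriers (technique_class: Weil-positivity parity-order symmetry-breaking converse): - technique_class: Weil-positivity parity-order symmetry-breaking converse
- Literature.Barriers.RiemannHypothesis.NewmanConjecture: EVADED in form — X is a ratio statement
(ε₋/ε₊ ≍ c² → ∞ in the prolate model) with a growing margin, not a positivity statement with margin
→ 0; conceded that EvenWinsBeyondArch is still RH-strength (crux #2), so the barrier's moral ("no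
zero-blind proof") bites on HOW #3 can be proved, not on the statement's robustness.
- Literature.Barriers.RiemannHypothesis.DeBrangesPositivity: not engaged — no kernel positivity of ξ
stronger than Weil's is asserted; the Conrey–Li counterexamples concern de Branges' (3.1)/(3.3), and
X is sign-blind.
- Literature.Barriers.RiemannHypothesis.LittlewoodOscillation: used as a RESOURCE, not contradicted
— crux #2 is an oscillation theorem in spirit (under ¬RH the splitting ε₋ − ε₊ changes sign in a,
like ψ(x) − x = Ω±); no one-signed prime-counting error is claimed anywhere.
- Literature.Barriers.RiemannHypothesis.JensenPolynomials: the "RH to a rung" warning applies to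
EvenWinsArch (a bounded-window rung, honest and RH-free); the route's RH content is the ∀-window
order, flagged.
- Literature.Barriers.RiemannHypothesis.DiamondMontgomeryVorhauer2006_thm1: the
Beurling/Landau-method barrier applies to crux #3 only — crux #2 uses just the explicit-formula
structure (any conjugation- and reflection-symmetric zero multiset) and would hold for Beurling-type
systems with a Weil-type explicit formula too, so all ℤ-specifi

sub-problem: RiemannHypothesis · status: open · opened planner-plan-lens-RiemannHypothesis-recomb-0 2026-08-16T15:08:47Z · rev 3 · ledger route-RiemannHypothesis-WeilParity
GENERATED by the gate from the ledger (D-0016/17). Provers cite these decls: `theorem foo : Summit.RiemannHypothesis.RiemannHypothesis.Theses.WeilParity.<Decl> := …` in Summits/RiemannHypothesis/RiemannHypothesis/Theorems/<Name>.lean.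
-/

namespace Summit.RiemannHypothesis.RiemannHypothesis.Theses.WeilParity

open scoped BigOperators Topology Manifold Classical MeasureTheory ProbabilityTheory Matrix InnerProductSpace ComplexConjugate ContinuousMap
open Filter Set Function TopologicalSpace MeasureTheory

attribute [summit_statement] _root_.Summit.RiemannHypothesis

open Summit

/-- item stmt-RiemannHypothesis-15430 · target · rank 0 · open · by planner
why it might fail: RH-strength by OffLineParityDetection (false iff RH false, if that crux holds); under RH still only heuristic (prolate model ε₋/ε₊ ≍ c²): an exceptional window where the odd ground state out-threads the zeros better than the even one would refute X with RH intact.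
sources: Bombieri2000Weil, Suzuki2026, ConnesSuijlekom2025, Connes2026Letter, ConnesConsani2023
[target] for every a > 0, every odd L²-normalised Weil test on [−a, a] and every δ > 0 there is an
even L²-normalised Weil test on [−a, a] whose Re Q exceeds the odd one's by at most δ (ε₊(a) ≤
ε₋(a): the ground energy is always attained in the even sector). -/
@[route_item "route-RiemannHypothesis-WeilParity"]
def EvenSectorWins : Prop :=
  ∀ a : ℝ, 0 < a → ∀ o : ℝ → ℂ, Literature.NumberTheory.LFunctions.IsWeilTest o → tsupport o ⊆ Set.Icc (-a) a → (∀ t, o (-t) = -o t) → ∫ t, ‖o t‖ ^ 2 = (1 : ℝ) → ∀ δ : ℝ, 0 < δ → ∃ e : ℝ → ℂ, Literature.NumberTheory.LFunctions.IsWeilTest e ∧ tsupport e ⊆ Set.Icc (-a) a ∧ (∀ t, e (-t) = e t) ∧ ∫ t, ‖e t‖ ^ 2 = (1 : ℝ) ∧ (Literature.NumberTheory.LFunctions.weilQuadratic e).re ≤ (Literature.NumberTheory.LFunctions.weilQuadratic o).re + δ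

/-- item stmt-RiemannHypothesis-15431 · crux · rank 2 · open · by planner
why it might fail: Needs a LOWER bound on the even bottom under ¬RH to relative precision η/γ₀: on-line detuning interference is of the same order as the off-line splitting (sinh-profiles have 1/x lobes); with infinitely many off-line zeros no quadruple dominates; no Landau lemma for an inf-functional exists.
sources: Bombieri2000Weil, Yoshida1992, arXiv:2606.09096, ConnesSuijlekom2025
[crux] PARITY SYMMETRY BREAKING DETECTS OFF-LINE ZEROS: if ζ(ρ) = 0 with 0 < Re ρ < 1 and Re ρ ≠
1/2, then at some window a > 0 some odd normalised Weil test o beats every even normalised Weil test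
by a fixed margin m > 0 (the odd sector strictly wins). Mechanism: explicit formula sector
identities (+4 Re G(z₀)² even / −4 Re G(z₀)² odd for real tests), optimal sinh(ηt)cos/sin(γ₀t)
profiles with splitting ∝ e^{2ηa}cos(2γ₀a − φ)/γ₀, on-line detuning interference of the same order
η/γ₀ and the same phase 2γ₀a, Bohr almost-periodicity / Landau-type sign change in a; infinitely
many off-line zeros handled by zero-density and an extremal-offset selection. [difficulty: XL] -/
@[route_item "route-RiemannHypothesis-WeilParity", crux]
def OffLineParityDetection : Prop :=
  ∀ ρ : ℂ, riemannZeta ρ = 0 → 0 < ρ.re → ρ.re < 1 → ρ.re ≠ 1 / 2 → ∃ a : ℝ, 0 < a ∧ ∃ o : ℝ → ℂ, Literature.NumberTheory.LFunctions.IsWeilTest o ∧ tsupport o ⊆ Set.Icc (-a) a ∧ (∀ t, o (-t) = -o t) ∧ ∫ t, ‖o t‖ ^ 2 = (1 : ℝ) ∧ ∃ m : ℝ, 0 < m ∧ ∀ e : ℝ → ℂ, Literature.NumberTheory.LFunctions.IsWeilTest e → tsupport e ⊆ Set.Icc (-a) a → (∀ t, e (-t) = e t) → ∫ t, ‖e t‖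 ^ 2 = (1 : ℝ) → (Literature.NumberTheory.LFunctions.weilQuadratic o).re + m ≤ (Literature.NumberTheory.LFunctions.weilQuadratic e).re

/-- item stmt-RiemannHypothesis-15432 · crux · rank 3 · open · by planner
why it might fail: RH-strength (crux #2): any proof must be zero-sensitive (no Perron–Frobenius/Beurling–Deny lever survives the pole form +2|⟨g,cosh⟩|²); beyond a ≈ 0.75 both bottoms are < 1e−11 (precision wall), so numerics arbitrate only the ORDER via ratios, never absolutely.
sources: Connes2026Letter, ConnesConsani2023, ConnesSuijlekom2025, Bombieri2000Weil, arXiv:2605.20224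
[crux] the thesis on every window a > (log 2)/2 (primes present): every odd normalised Weil test on
[−a, a] is matched up to any δ > 0 by an even one. The RH-bearing half: by crux #2 it is false under
¬RH; under RH it is Connes' prolate picture (even = Fourier-sign-0 sector wins by a factor ≍ c²),
and the data (odd/even ratio 57 → 640 on [0.35, 0.7], interlacing even<odd<even… of the first levels
on [0.01, 1.2]) support it. [difficulty: open-problem] -/
@[route_item "route-RiemannHypothesis-WeilParity", crux]
def EvenWinsBeyondArch : Prop :=
  ∀ a : ℝ, Real.log 2 / 2 < a → ∀ o : ℝ → ℂ, Literature.NumberTheory.LFunctions.IsWeilTest o → tsupport o ⊆ Set.Icc (-a) a → (∀ t, o (-t) = -o t) → ∫ t, ‖o t‖ ^ 2 = (1 : ℝ) → ∀ δ : ℝ, 0 < δ → ∃ e : ℝ → ℂ, Literature.NumberTheory.LFunctions.IsWeilTest e ∧ tsupport e ⊆ Set.Icc (-a) a ∧ (∀ t, e (-t) = e t) ∧ ∫ t, ‖e t‖ ^ 2 = (1 : ℝ) ∧ (Literature.NumberTheory.LFunctions.weilQuadratic e).re ≤ (Literature.NumberTheory.LFunctions.weilQuadratic o).re + δ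

/-- item stmt-RiemannHypothesis-15433 · crux · rank 4 · closed · proved by Summit.RiemannHypothesis.RiemannHypothesis.Theorems.WeilParity.evenWinsArch_proof @ 0d1f68833b96 (prover) · by planner
why it might fail: The pole form pushes the even sector UP by 2|⟨g,cosh(t/2)⟩|² ≈ 4a and pulls the odd sector DOWN by 2|⟨g,sinh(t/2)⟩|²; at a ≈ 0.35 the push is of the order of the log-symbol parity gap, so the order could flip inside (1/100, (log 2)/2) despite both endpoints being certified.
sources: Suzuki2026, ConnesConsani2023, Bombieri2000Weil, arXiv:2006.13771
[crux] the PRIME-FREE PARITY THEOREM: for 0 < a ≤ (log 2)/2 (no prime power enters W(g ⋆ g̃); the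
form is polar + digamma only) the even sector wins, ε₊(a) ≤ ε₋(a), in the same junk-free matching
form. A statement about the archimedean kernel alone, RH-free and certifiable: known at a ≤ 1/100
(Suzuki2026 Thm 1.4, strict) and at a = (log 2)/2 (WeilGroundState item ArchimedeanWindowSimpleEven,
proved); the interval in between needs a-uniform certified sector bounds (Rayleigh–Ritz upper for
even, Temple/Lehmann–Goerisch lower for odd) plus the sector Lipschitz modulus (WeilWindowFlow
toolkit). [difficulty: L] -/
@[route_item "route-RiemannHypothesis-WeilParity", crux]
def EvenWinsArch : Prop :=
  ∀ a : ℝ, 0 < a → a ≤ Real.log 2 / 2 → ∀ o : ℝ → ℂ, Literature.NumberTheory.LFunctions.IsWeilTest o → tsupport o ⊆ Set.Icc (-a) a → (∀ t, o (-t) = -o t) → ∫ t, ‖o t‖ ^ 2 = (1 : ℝ) → ∀ δ : ℝ, 0 < δ → ∃ e : ℝ → ℂ, Literature.NumberTheory.LFunctions.IsWeilTest e ∧ tsupport e ⊆ Set.Icc (-a) a ∧ (∀ t, e (-t) = e t) ∧ ∫ t, ‖e t‖ ^ 2 = (1 : ℝ) ∧ (Literature.NumberTheory.LFunctions.weilQuadratic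 e).re ≤ (Literature.NumberTheory.LFunctions.weilQuadratic o).re + δ

/-- item stmt-RiemannHypothesis-18084 · crux · rank 5 · closed · proved by Summit.RiemannHypothesis.RiemannHypothesis.Theorems.WeilParity.onePrimeWindowSimpleEven_proof @ ea8c89e7ebde (prover) · by planner
why it might fail: Needs CERTIFIED odd-sector lower bounds down to ≈1e-5 absolute at c = (log 3)/2 with the prime-2 comb term in the kernel; the tree's gap certificates (item 1529) were exercised only at the 5e-2 level on the prime-free window — Galerkin truncation/tail bounds may not reach 1e-5.
sources: ConnesSuijlekom2025, Connes2026Letter, Bombieri2000Weil, Suzuki2026, arXiv:2106.01715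
[crux] ONE-PRIME PARITY THEOREM (RH-free, certifiable): on every window (log 2)/2 < a ≤ (log 3)/2 —
exactly one prime power, 2, enters Weil's windowed form — the bottom of the form is simple, isolated
and even (the Connes–van Suijlekom clause WeilWindowSimpleEven a), hence ε_ev(a) < ε_od(a) strictly.
Continuation of the archimedean rung ArchimedeanWindowSimpleEven (route WeilGroundState: proved at a
= (log 2)/2 and on [1/3, (log 2)/2]) by the LANDED cell-transfer method
(Theorems/WeilGroundStateGroundStateSimpleEvenCellTransfer.lean, weilWindowSimpleEven_on_cell_of_le:
per cell [b, c] one even trial upper bound U ≥ ε(b) at the left end and one certified odd-sector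
lower bound L at the right end with U < L; antitone bottoms, no continuity and no even-complement
bound needed). Numerics (Cruxes/GroundStateSimpleEven/Disproof.lean table, kit j016728/j016733): e1
= 1.33e-3 at (log 2)/2, 1.8e-4 at 0.4, 9.4e-7 at 0.5, ≈4e-8 at (log 3)/2; o1/e1 = 55 → 81 → 208 →
≈250: four cells {(log 2)/2, 2/5, 9/20, 1/2, (log 3)/2} each satisfy ε(b) < ε_od(c) with margin ≈
10×. Supplies the anchor ε_ev((log 3)/2) < ε_od((log 3)/2) for the IVT propagation of the sibling
NoParityCrossing (glue evenWinsBeyo -/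
@[route_item "route-RiemannHypothesis-WeilParity", crux]
def OnePrimeWindowSimpleEven : Prop :=
  ∀ a : ℝ, Real.log 2 / 2 < a → a ≤ Real.log 3 / 2 → Literature.NumberTheory.LFunctions.WeilWindowSimpleEven a

/-- item stmt-RiemannHypothesis-18085 · crux · rank 6 · open · by planner
why it might fail: RH-strength: under ¬RH, OffLineParityDetection + landed sector continuity force a tie at some a > (log 3)/2; under RH only the prolate heuristic and numerics (sectors of different symmetry cross freely in generic families; a tie is an equality, uncertifiable beyond a ≈ 0.75).
sources: Connes2026Letter, ConnesSuijlekom2025, ConnesConsani2023, Bombieri2000Weil, arXiv:2605.20224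
[crux] NO PARITY LEVEL-CROSSING — the RH-bearing residue of EvenWinsBeyondArch, stated
parity-SYMMETRICALLY (sign-blind): beyond the one-prime window the even and odd sector bottoms
ε_ev(a) = weilEvenGroundEnergy a and ε_od(a) = weilOddGroundEnergy a (Bombieri's μ⁺(e^a), μ⁻(e^a))
never coincide. With the LANDED RH-free sector continuity
(Theorems/WeilParityEvenWinsBeyondArchStubSectorContinuity.lean, Bombieri 2000 Thm 5 per sector) and
the anchor ε_ev < ε_od at a = (log 3)/2 supplied by the sibling OnePrimeWindowSimpleEven, the
intermediate value theorem propagates the strict order to every a > (log 3)/2 (glue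
evenWinsBeyondArch_of_subs, kernel-checked). Modulo landed RH-free theorems (halving theorem
weilWindowSimpleEven_iff_oddSectorGap, cell transfer, sector continuity) it is Connes' 'lowest
eigenvalue simple and even' on a > (log 3)/2 — the residue route WeilGroundState's
GroundStateSimpleEven also reduces to — but in the shape 'the parity gap never closes', which
finite-range certificates (antitone bottoms: ε(b) < ε_od(c) per cell, precision wall a ≈ 0.75) and
Connes' prolate picture (sector defects 1−λ₀(c) ≪ 1−λ₁(c); data o1/e1 = 250 → 625 → 2569 → ≈6000 on
a ∈ [0.55, 1.2], m -/
@[route_item "route-RiemannHypothesis-WeilParity", crux]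
def NoParityCrossing : Prop :=
  ∀ a : ℝ, Real.log 3 / 2 < a → Literature.NumberTheory.LFunctions.weilEvenGroundEnergy a ≠ Literature.NumberTheory.LFunctions.weilOddGroundEnergy a

/-- item stmt-RiemannHypothesis-15434 · support · rank 9 · closed · proved by Summit.RiemannHypothesis.RiemannHypothesis.Theorems.WeilParity.parityGlue_proof @ 2d78371afabd (prover) · by planner
sources: Bombieri2000Weil
[support] pure logic: the two window ranges give the target (case split at a = (log 2)/2); proved in
the planner's Sketch.lean (parityGlue_proof). [difficulty: provable-now] -/
@[route_item "route-RiemannHypothesis-WeilParity"]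
def ParityGlue : Prop :=
  EvenWinsArch → EvenWinsBeyondArch → EvenSectorWins

/-- item stmt-RiemannHypothesis-15435 · support · rank 9 · open · by planner
sources: Bombieri2000Weil, Yoshida1992
[support] FINITE-DEFECT RUNG of crux #2 (Bombieri's setting, Thm 8 / §13): if the set of off-line
zeros of ζ in the strip is finite and nonempty, the odd sector strictly wins at some window. Here
one quadruple of maximal offset η dominates, the splitting ε₋ − ε₊ is asymptotic to a finite
trigonometric sum in a with the common phase 2γ₀a, and Bohr almost-periodicity gives sign changes —
the first honest theorem of the detection mechanism, RH-free (its hypothesis is the finite-defect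
alternative). [difficulty: L] -/
@[route_item "route-RiemannHypothesis-WeilParity"]
def FiniteDefectParityAlternation : Prop :=
  ({ρ : ℂ | riemannZeta ρ = 0 ∧ 0 < ρ.re ∧ ρ.re < 1 ∧ ρ.re ≠ 1 / 2}).Finite → (∃ ρ : ℂ, riemannZeta ρ = 0 ∧ 0 < ρ.re ∧ ρ.re < 1 ∧ ρ.re ≠ 1 / 2) → ∃ a : ℝ, 0 < a ∧ ∃ o : ℝ → ℂ, Literature.NumberTheory.LFunctions.IsWeilTest o ∧ tsupport o ⊆ Set.Icc (-a) a ∧ (∀ t, o (-t) = -o t) ∧ ∫ t, ‖o t‖ ^ 2 = (1 : ℝ) ∧ ∃ m : ℝ, 0 < m ∧ ∀ e : ℝ → ℂ, Literature.NumberTheory.LFunctions.IsWeilTest e → tsupport e ⊆ Set.Icc (-a) a → (∀ t, e (-t) = e t) → ∫ t, ‖e t‖ ^ 2 = (1 : ℝ) → (Literature.NumberTheory.LFunctions.weilQuadratic o).re + m ≤ (Literature.NumberTheory.LFunctions.weilQuadratic e).re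

/-- item stmt-RiemannHypothesis-15436 · support · rank 9 · open · by planner
sources: Connes2026Letter, ConnesConsani2023, Bombieri2000Weil
[support] CALIBRATION (open, off the deciding path): RH implies the thesis. Expected by Connes'
prolate model (even sector = Fourier-sign 0, odd = sign 2; defects 1−λ₄(c) ≪ 1−λ₆(c)); the cheap
division lever (RH ⇒ Q(∫o) ≤ Q(o)/γ₁² for odd o, (∫o)^(s) = −ô(s)/(s−½)) proves it only at windows
whose odd ground state has ‖o‖ ≤ γ₁‖∫o‖, which fails for zero-threading (high-frequency) minimisers
— so a proof needs the prolate approximation of BOTH sector ground states. Recorded so that X's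
exact logical status (equivalent to RH, or strictly stronger) is an item, not a footnote.
[difficulty: open-problem] -/
@[route_item "route-RiemannHypothesis-WeilParity"]
def RHImpliesEvenWins : Prop :=
  Summit.RiemannHypothesis → EvenSectorWins

/-- item stmt-RiemannHypothesis-17975 · support · rank 9 · closed · proved by Summit.RiemannHypothesis.RiemannHypothesis.Theorems.WeilParity.evenWinsBeyondArchOfPieces_proof @ 602dfee3ec47 (prover) · by planner
sources: Bombieri2000Weil, ConnesSuijlekom2025
[glue for EvenWinsBeyondArch] SPLIT GLUE of crux #3 (strategist cstrat stmt-RiemannHypothesis-15432;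
certificate (a)-(d) in Cruxes/EvenWinsBeyondArch/DECOMPOSITION.md): the two filed pieces
OnePrimeWindowSimpleEven (stmt-RiemannHypothesis-18084, the Connes–van Suijlekom clause on the
one-prime window (log 2)/2 < a ≤ (log 3)/2, RH-free, certifiable by cell transfer) and
NoParityCrossing (stmt-RiemannHypothesis-18085, no parity tie for a > (log 3)/2, the RH-bearing
residue) imply EvenWinsBeyondArch. PROVABLE NOW, one line: `:=
Summit.RiemannHypothesis.RiemannHypothesis.Theorems.EvenWinsBeyondArch.evenWinsBeyondArch_of_subs`
(LANDED, Theorems/WeilParityEvenWinsBeyondArchSplit.lean, p148526: strict order ε_ev < ε_od on the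
one-prime window from the clause, IVT propagation beyond the anchor (log 3)/2 by the landed RH-free
sector continuity stub_sectorContinuity (Bombieri 2000 Thm 5 per sector) + no tie, then
evenWinsBeyondArch_of_forall_le). Filed as an item rather than `--glue-by` because that Theorems
module imports this route file (import cycle), and as a plain support item rather than a `--split`
record because split is final-cycle-only for this seat; it is what connects cruxes #5/# -/
@[route_item "route-RiemannHypothesis-WeilParity"]
def EvenWinsBeyondArchOfPieces : Prop :=
  OnePrimeWindowSimpleEven → NoParityCrossing → EvenWinsBeyondArch

/-- item stmt-RiemannHypothesis-15437 · assembly · rank 1 · closed · proved by Summit.RiemannHypothesis.RiemannHypothesis.Theorems.WeilParity.assembly_proof @ 83bbbbabf435 (prover) · by planner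
sources: Bombieri2000Weil, Weil1952
[assembly] EvenSectorWins → OffLineParityDetection → RiemannHypothesis (proved in Sketch.lean,
assembly_proof). -/
@[route_item "route-RiemannHypothesis-WeilParity"]
def Assembly : Prop :=
  EvenSectorWins → OffLineParityDetection → Summit.RiemannHypothesis

/-! D-0027 §2.1 — DECIDING THEOREM (planner-authored via `route open/edit --closes-file`; by planner-plan-lens-RiemannHypothesis-recomb-0 2026-08-16T15:08:47Z):
its hypotheses are this route's items and its conclusion the sub-problem Statement (glue_lint), and it elaborates with this file. -/

/-- DECIDING THEOREM (D-0027 §2.1) of route WeilParity. Given a nontrivial zero `s` of `ζ`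
(Mathlib's binder), `riemannXi_eq_zero_of_nontrivial` + `riemannXi_eq_zero_iff_holds` put it in the
open strip; if `Re s ≠ 1/2`, `OffLineParityDetection` yields a window `a`, an odd normalised test `o`
and a margin `m > 0` below EVERY even normalised test on that window, while the thesis (the two
ranges `EvenWinsArch` / `EvenWinsBeyondArch`, case split at `a = (log 2)/2`) yields an even test
within `m/2` of `o` — contradiction. Axioms: propext, Classical.choice, Quot.sound. -/
@[closes "route-RiemannHypothesis-WeilParity"] theorem closes (hArch : EvenWinsArch) (hBeyond : EvenWinsBeyondArch)
    (hDet : OffLineParityDetection) : _root_.Summit.RiemannHypothesis := by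
  show _root_.RiemannHypothesis
  intro s hzeta htriv hone
  have hxi := _root_.Literature.NumberTheory.LFunctions.riemannXi_eq_zero_of_nontrivial hzeta htriv hone
  obtain ⟨-, h0, h1⟩ :=
    (_root_.Literature.NumberTheory.LFunctions.riemannXi_eq_zero_iff_holds s).1 hxi
  by_contra hne
  obtain ⟨a, ha, o, ho, hos, hodd, hon, m, hm, hdet⟩ := hDet s hzeta h0 h1 hne
  have hEW : ∃ e : ℝ → ℂ, _root_.Literature.NumberTheory.LFunctions.IsWeilTest e ∧
      tsupport e ⊆ Set.Icc (-a) a ∧ (∀ t, e (-t) = e t) ∧ ∫ t, ‖e t‖ ^ 2 = (1 : ℝ) ∧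
      (_root_.Literature.NumberTheory.LFunctions.weilQuadratic e).re ≤
        (_root_.Literature.NumberTheory.LFunctions.weilQuadratic o).re + m / 2 := by
    rcases le_or_gt a (Real.log 2 / 2) with hle | hlt
    · exact hArch a ha hle o ho hos hodd hon (m / 2) (by linarith)
    · exact hBeyond a hlt o ho hos hodd hon (m / 2) (by linarith)
  obtain ⟨e, he, hes, hev, hen, hle⟩ := hEW
  have h := hdet e he hes hev hen
  linarith

end Summit.RiemannHypothesis.RiemannHypothesis.Theses.WeilParity
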